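import Summits.RiemannHypothesis.RiemannHypothesis.Theorems.PfPersistenceEdgeLawCuspDefect

/-!
# Edge law — the cusp modulus from a weighted derivative bound (RH-free)

Part of the pub-rhpf THEORY-2 programme (mechanism / rigidity of the Weil window bottom; no RH
claims). The derivative form of the cusp-modulus hypothesis: if the ground state `u` is
differentiable on the open window with the **cusp derivative bound**
`‖u'(x)‖ ≤ C ψ_a(a − |x|) = C / ((a−|x|) Λ_a(a−|x|)^{3/2})` and `u → 0` at the two edges, then
`ũ = 1_{(-a,a)} u` is `C`-Lipschitz in the cusp coordinate (`HasCuspModulus a u C`), hence (gen 6,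
`PfPersistenceEdgeLawCuspDefect`) the interior dilation defect is `o(η)` (R3) and the log-Pohozaev
identity / two-sided edge law hold at differentiability windows.

* `norm_weilTrunc_sub_le_of_derivBound` — the interior mean-value estimate;
* `hasCuspModulus_of_derivBound` — **derivative bound + edge limits ⇒ cusp modulus**;
* `hasInteriorRegularDefect_of_derivBound` — ⇒ (R3);
* `hasCuspModulus_cuspModel` — non-vacuity: the cusp-shaped model `G(a)² − Γ(x)²` has cusp
  modulus `2G(a)`.

Sources: E. Bombieri, Rend. Mat. Acc. Lincei (9) 11 (2000) §4, §6 (the dilation / variational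
equation); X. Ros-Oton, J. Serra, J. Math. Pures Appl. 101 (2014) (model gradient bound, statement
only).
-/

set_option linter.dupNamespace false

noncomputable section

open MeasureTheory Set Filter
open scoped Topology

namespace Summit.RiemannHypothesis.RiemannHypothesis.Theorems.PfPersistence

open Literature.NumberTheory.LFunctions

variable {a : ℝ} {u : ℝ → ℂ}

/-- **Cusp derivative bound** (RH-free regularity HYPOTHESIS, derivative form): `u` is
differentiable on the open window and `‖u'(x)‖ ≤ C ψ_a(a − |x|)` there. [folklore] -/
def HasCuspDerivBound (a : ℝ) (u : ℝ → ℂ) (C : ℝ) : Prop :=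
  ∀ x, |x| < a → ∃ u' : ℂ, HasDerivAt u u' x ∧ ‖u'‖ ≤ C * cuspWeight a (a - |x|)

/-- `ũ = u` near every point of the open window. [folklore] -/
theorem weilTrunc_eventuallyEq {x : ℝ} (hx : |x| < a) : weilTrunc a u =ᶠ[𝓝 x] u := by
  have hm : Ioo (-a) a ∈ 𝓝 x := Ioo_mem_nhds (by linarith [(abs_lt.1 hx).1]) (abs_lt.1 hx).2
  filter_upwards [hm] with y hy
  simp only [weilTrunc, indicator_of_mem hy]

/-- `ũ` inherits the derivative of `u` on the open window. [folklore] -/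
theorem hasDerivAt_weilTrunc {x : ℝ} {u' : ℂ} (hd : HasDerivAt u u' x) (hx : |x| < a) :
    HasDerivAt (weilTrunc a u) u' x :=
  hd.congr_of_eventuallyEq (weilTrunc_eventuallyEq hx)

/-- **Interior mean-value estimate**: under the cusp derivative bound,
`‖ũ(y) − ũ(x)‖ ≤ C (Γ_a(y) − Γ_a(x))` for `−a < x ≤ y < a`. [folklore] -/
theorem norm_weilTrunc_sub_le_of_derivBound {C : ℝ} (hd : HasCuspDerivBound a u C) {x y : ℝ}
    (hx : -a < x) (hxy : x ≤ y) (hy : y < a) :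
    ‖weilTrunc a u y - weilTrunc a u x‖ ≤ C * (cuspCoord a y - cuspCoord a x) := by
  have hmem : ∀ z ∈ Icc x y, |z| < a := fun z hz ↦
    abs_lt.2 ⟨by linarith [hz.1], by linarith [hz.2]⟩
  choose! f' hf' using hd
  have hder : ∀ z ∈ Icc x y, HasDerivAt (weilTrunc a u) (f' z) z := fun z hz ↦
    hasDerivAt_weilTrunc (hf' z (hmem z hz)).1 (hmem z hz)
  have hcont : ContinuousOn (fun z ↦ weilTrunc a u z - weilTrunc a u x) (Icc x y) := fun z hz ↦
    ((hder z hz).continuousAt.sub continuousAt_const).continuousWithinAt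
  have hB : ContinuousOn (fun z ↦ C * (cuspCoord a z - cuspCoord a x)) (Icc x y) := fun z hz ↦
    (continuousAt_const.mul ((continuousAt_cuspCoord (hmem z hz)).sub
      continuousAt_const)).continuousWithinAt
  have key := image_norm_le_of_norm_deriv_right_le_deriv_boundary'
    (f := fun z ↦ weilTrunc a u z - weilTrunc a u x) (f' := f') (a := x) (b := y) hcont
    (fun z hz ↦ ((hder z (Ico_subset_Icc_self hz)).sub_const (weilTrunc a u x)).hasDerivWithinAt)
    (B := fun z ↦ C * (cuspCoord a z - cuspCoord a x))
    (B' := fun z ↦ C * cuspWeight a (a - |z|)) (by simp) hB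
    (fun z hz ↦ (((hasDerivAt_cuspCoord (hmem z (Ico_subset_Icc_self hz))).sub_const
      (cuspCoord a x)).const_mul C).hasDerivWithinAt)
    (fun z hz ↦ (hf' z (hmem z (Ico_subset_Icc_self hz))).2)
  exact key (right_mem_Icc.2 hxy)

/-- **Derivative bound + edge limits ⇒ cusp modulus.** If `u` satisfies the cusp derivative
bound with constant `C ≥ 0` on the open window and `u → 0` at both edges, then
`HasCuspModulus a u C`. [folklore] -/
theorem hasCuspModulus_of_derivBound (ha : 0 < a) {C : ℝ} (hC : 0 ≤ C)
    (hd : HasCuspDerivBound a u C) (hl : Tendsto u (𝓝[<] a) (𝓝 0))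
    (hr : Tendsto u (𝓝[>] (-a)) (𝓝 0)) : HasCuspModulus a u C := by
  intro x y hx hxy hy
  rcases eq_or_lt_of_le hxy with h | hxy'
  · subst h; simp
  have hGa : cuspCoord a a = cuspPrim a a := cuspCoord_self ha.le
  have hGna : cuspCoord a (-a) = -cuspPrim a a := cuspCoord_neg_self ha.le
  have hza : weilTrunc a u a = 0 := weilTrunc_eq_zero u (by rw [abs_of_pos ha])
  have hzna : weilTrunc a u (-a) = 0 := weilTrunc_eq_zero u (by rw [abs_neg, abs_of_pos ha])
  -- the edge limits of `ũ`
  have hla : Tendsto (weilTrunc a u) (𝓝[<] a) (𝓝 0) := by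
    refine hl.congr' ?_
    filter_upwards [Ioo_mem_nhdsLT (show -a < a by linarith)] with z hz
    simp only [weilTrunc, indicator_of_mem hz]
  have hra : Tendsto (weilTrunc a u) (𝓝[>] (-a)) (𝓝 0) := by
    refine hr.congr' ?_
    filter_upwards [Ioo_mem_nhdsGT (show -a < a by linarith)] with z hz
    simp only [weilTrunc, indicator_of_mem hz]
  -- the estimate up to the right edge
  have hya : ∀ x', -a < x' → x' < a →
      ‖weilTrunc a u a - weilTrunc a u x'‖ ≤ C * (cuspCoord a a - cuspCoord a x') := by
    intro x' hx' hxa'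
    have ht : Tendsto (fun z ↦ ‖weilTrunc a u z - weilTrunc a u x'‖) (𝓝[<] a)
        (𝓝 ‖0 - weilTrunc a u x'‖) := (hla.sub_const (weilTrunc a u x')).norm
    rw [hza]
    refine le_of_tendsto ht ?_
    filter_upwards [Ioo_mem_nhdsLT hxa'] with z hz
    refine (norm_weilTrunc_sub_le_of_derivBound hd hx' hz.1.le hz.2).trans ?_
    have := cuspCoord_le (a := a) (y := z) (by linarith [hz.1])
    exact mul_le_mul_of_nonneg_left (by linarith) hC
  -- the estimate from the left edge
  have hxa : ∀ y', -a < y' → y' < a →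
      ‖weilTrunc a u y' - weilTrunc a u (-a)‖ ≤ C * (cuspCoord a y' - cuspCoord a (-a)) := by
    intro y' hy' hya'
    have ht : Tendsto (fun z ↦ ‖weilTrunc a u y' - weilTrunc a u z‖) (𝓝[>] (-a))
        (𝓝 ‖weilTrunc a u y' - 0‖) := (tendsto_const_nhds.sub hra).norm
    rw [hzna]
    refine le_of_tendsto ht ?_
    filter_upwards [Ioo_mem_nhdsGT hy'] with z hz
    refine (norm_weilTrunc_sub_le_of_derivBound hd hz.1 hz.2.le hya').trans ?_
    have := neg_le_cuspCoord (a := a) (y := z) (by linarith [hz.2])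
    exact mul_le_mul_of_nonneg_left (by linarith) hC
  rcases eq_or_lt_of_le hy with h | hy'
  · rw [h] at hxy' ⊢
    rcases eq_or_lt_of_le hx with h' | hx''
    · rw [← h', hza, hzna, sub_zero, norm_zero, hGa, hGna]
      nlinarith [cuspPrim_nonneg a a]
    · exact hya x hx'' hxy'
  · rcases eq_or_lt_of_le hx with h' | hx''
    · rw [← h'] at hxy' ⊢
      exact hxa y hxy' hy'
    · exact norm_weilTrunc_sub_le_of_derivBound hd hx'' hxy'.le hy'

/-- **Cusp derivative bound ⇒ (R3).** A Weil ground state with the cusp derivative bound on the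
open window and vanishing edge limits has an `o(η)` interior dilation defect.
[cite: Bombieri2000Weil, §4 Thm 5, §6] -/
theorem hasInteriorRegularDefect_of_derivBound (hu : IsWeilGroundState a u) {C : ℝ} (hC : 0 ≤ C)
    (hd : HasCuspDerivBound a u C) (hl : Tendsto u (𝓝[<] a) (𝓝 0))
    (hr : Tendsto u (𝓝[>] (-a)) (𝓝 0)) : HasInteriorRegularDefect a u :=
  hasInteriorRegularDefect_of_cuspModulus hu (hasCuspModulus_of_derivBound hu.pos hC hd hl hr)

/-- **The log-Pohozaev identity under the cusp derivative bound** at a differentiability window: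
`V = 2c₀·a·I`. [cite: Bombieri2000Weil, §4 Thm 3, §6] -/
theorem virial_eq_of_derivBound (hu : IsWeilGroundState a u) {C : ℝ} (hC : 0 ≤ C)
    (hd : HasCuspDerivBound a u C) (hl : Tendsto u (𝓝[<] a) (𝓝 0))
    (hr : Tendsto u (𝓝[>] (-a)) (𝓝 0)) (hdiff : DifferentiableAt ℝ weilGroundEnergy a) {V I : ℝ}
    (hV : HasDerivAt (weilDilationProfile a u) V 0) (hI : HasEdgeIntensity u a I) :
    V = 2 * edgeLawKernelConstant * a * I :=
  virial_eq_of_cuspModulus hu (hasCuspModulus_of_derivBound hu.pos hC hd hl hr) hdiff hV hI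

/-- **Two-sided edge law under the cusp derivative bound**: `ε'(a) = −2c₀·I(u)` at a
differentiability window. [cite: Bombieri2000Weil, §6] -/
theorem deriv_weilGroundEnergy_eq_of_derivBound (hu : IsWeilGroundState a u) {C : ℝ}
    (hC : 0 ≤ C) (hd : HasCuspDerivBound a u C) (hl : Tendsto u (𝓝[<] a) (𝓝 0))
    (hr : Tendsto u (𝓝[>] (-a)) (𝓝 0)) (hdiff : DifferentiableAt ℝ weilGroundEnergy a) {V I : ℝ}
    (hV : HasDerivAt (weilDilationProfile a u) V 0) (hI : HasEdgeIntensity u a I) :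
    deriv weilGroundEnergy a = -(2 * edgeLawKernelConstant * I) :=
  deriv_weilGroundEnergy_eq_of_cuspModulus hu (hasCuspModulus_of_derivBound hu.pos hC hd hl hr)
    hdiff hV hI

/-! ## Non-vacuity: the cusp-shaped model profile satisfies the hypothesis -/

/-- The **cusp model** `m_a(x) = G_a(a)² − Γ_a(x)²` (`= (2G(a) − G(a−|x|))·G(a−|x|)` on the window:
the expected `log^{-1/2}` cusp at both edges). Not claimed to be a ground state — it witnesses that
the hypothesis class of `HasCuspDerivBound` / `HasCuspModulus` contains cusp-shaped profiles.
[folklore] -/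
def cuspModel (a : ℝ) : ℝ → ℂ := fun x ↦ ((cuspPrim a a ^ 2 - cuspCoord a x ^ 2 : ℝ) : ℂ)

/-- The cusp model satisfies the cusp derivative bound with constant `2 G_a(a)`. [folklore] -/
theorem hasCuspDerivBound_cuspModel (a : ℝ) : HasCuspDerivBound a (cuspModel a) (2 * cuspPrim a a) := by
  intro x hx
  have ha : 0 < a := (abs_nonneg x).trans_lt hx
  have hψ : 0 < cuspWeight a (a - |x|) := cuspWeight_pos (by linarith) (by linarith [abs_nonneg x])
  have hΓ := hasDerivAt_cuspCoord hx
  have h1 := ((hΓ.mul hΓ).const_sub (cuspPrim a a ^ 2)).ofReal_comp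
  have e : cuspModel a = fun y ↦ ((cuspPrim a a ^ 2 - cuspCoord a y * cuspCoord a y : ℝ) : ℂ) := by
    funext y; simp [cuspModel, sq]
  rw [e]
  refine ⟨_, h1, ?_⟩
  have hb : |cuspCoord a x| ≤ cuspPrim a a :=
    abs_le.2 ⟨neg_le_cuspCoord (abs_lt.1 hx).2.le, cuspCoord_le (abs_lt.1 hx).1.le⟩
  rw [Complex.norm_real, Real.norm_eq_abs, abs_neg,
    show cuspWeight a (a - |x|) * cuspCoord a x + cuspCoord a x * cuspWeight a (a - |x|) =
      2 * cuspCoord a x * cuspWeight a (a - |x|) by ring, abs_mul, abs_mul, abs_two,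
    abs_of_pos hψ]
  gcongr

/-- The cusp model vanishes at the right edge. [folklore] -/
theorem tendsto_cuspModel_left (ha : 0 < a) : Tendsto (cuspModel a) (𝓝[<] a) (𝓝 0) := by
  have h1 : Tendsto (fun x ↦ a - x) (𝓝[<] a) (𝓝[>] 0) := by
    refine tendsto_nhdsWithin_iff.2 ⟨?_, ?_⟩
    · have h : Tendsto (fun x : ℝ ↦ a - x) (𝓝 a) (𝓝 (a - a)) := tendsto_const_nhds.sub tendsto_id
      rw [sub_self] at h
      exact h.mono_left nhdsWithin_le_nhds
    · filter_upwards [self_mem_nhdsWithin] with x hx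
      exact mem_Ioi.2 (by linarith [mem_Iio.1 hx])
  have h2 : Tendsto (fun x ↦ cuspPrim a (a - x)) (𝓝[<] a) (𝓝 0) := (tendsto_cuspPrim_zero a).comp h1
  have h3 : Tendsto (cuspCoord a) (𝓝[<] a) (𝓝 (cuspPrim a a)) := by
    have e : ∀ᶠ x in 𝓝[<] a, cuspPrim a a - cuspPrim a (a - x) = cuspCoord a x := by
      filter_upwards [Ioo_mem_nhdsLT ha] with x hx
      rw [cuspCoord_of_nonneg a hx.1.le]
    refine Tendsto.congr' e ?_
    simpa using tendsto_const_nhds.sub h2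
  have h4 := tendsto_const_nhds (x := cuspPrim a a ^ 2) |>.sub (h3.pow 2)
  rw [sub_self] at h4
  have h5 := (Complex.continuous_ofReal.tendsto 0).comp h4
  show Tendsto (fun x ↦ ((cuspPrim a a ^ 2 - cuspCoord a x ^ 2 : ℝ) : ℂ)) (𝓝[<] a) (𝓝 0)
  simpa [Function.comp_def] using h5

/-- The cusp model vanishes at the left edge. [folklore] -/
theorem tendsto_cuspModel_right (ha : 0 < a) : Tendsto (cuspModel a) (𝓝[>] (-a)) (𝓝 0) := by
  have h1 : Tendsto (fun x ↦ a + x) (𝓝[>] (-a)) (𝓝[>] 0) := by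
    refine tendsto_nhdsWithin_iff.2 ⟨?_, ?_⟩
    · have h : Tendsto (fun x : ℝ ↦ a + x) (𝓝 (-a)) (𝓝 (a + -a)) :=
        tendsto_const_nhds.add tendsto_id
      rw [add_neg_cancel] at h
      exact h.mono_left nhdsWithin_le_nhds
    · filter_upwards [self_mem_nhdsWithin] with x hx
      exact mem_Ioi.2 (by linarith [mem_Ioi.1 hx])
  have h2 : Tendsto (fun x ↦ cuspPrim a (a + x)) (𝓝[>] (-a)) (𝓝 0) :=
    (tendsto_cuspPrim_zero a).comp h1
  have h3 : Tendsto (cuspCoord a) (𝓝[>] (-a)) (𝓝 (-cuspPrim a a)) := by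
    have e : ∀ᶠ x in 𝓝[>] (-a), cuspPrim a (a + x) - cuspPrim a a = cuspCoord a x := by
      filter_upwards [Ioo_mem_nhdsGT (show -a < 0 by linarith)] with x hx
      rw [cuspCoord_of_nonpos a hx.2.le]
    refine Tendsto.congr' e ?_
    simpa using h2.sub tendsto_const_nhds
  have h4 := tendsto_const_nhds (x := cuspPrim a a ^ 2) |>.sub (h3.pow 2)
  rw [show cuspPrim a a ^ 2 - (-cuspPrim a a) ^ 2 = 0 by ring] at h4
  have h5 := (Complex.continuous_ofReal.tendsto 0).comp h4
  show Tendsto (fun x ↦ ((cuspPrim a a ^ 2 - cuspCoord a x ^ 2 : ℝ) : ℂ)) (𝓝[>] (-a)) (𝓝 0)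
  simpa [Function.comp_def] using h5

/-- **Non-vacuity**: the cusp model has cusp modulus `2 G_a(a)`. [folklore] -/
theorem hasCuspModulus_cuspModel (ha : 0 < a) : HasCuspModulus a (cuspModel a) (2 * cuspPrim a a) :=
  hasCuspModulus_of_derivBound ha (by positivity [cuspPrim_nonneg a a])
    (hasCuspDerivBound_cuspModel a) (tendsto_cuspModel_left ha) (tendsto_cuspModel_right ha)

end Summit.RiemannHypothesis.RiemannHypothesis.Theorems.PfPersistence

end
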